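import Literature.NumberTheory.Sieve.LevelOfDistribution
import Literature.AlgebraicGeometry.HodgeTheory.FermatHodgeCharacterCriterion

/-!
# `ElliottHalberstam` (stmt-Parity-14092): level lifting, I — the pointwise lever

Support lemmas for the crux `LiouvilleShiftedTables.ElliottHalberstam` (= `LiouvilleMAD.ElliottHalberstam` =
the Literature constant `Literature.NumberTheory.Sieve.LevelOfDistribution.ElliottHalberstam`, all by `rfl`),
line `LiftProof` (crux idea card `smooth-cofactor-lifting`, ideator 2; kernel-checked work file
`Cruxes/ElliottHalberstam/LiftingProved.lean`, landed here verbatim up to the namespace so that the skeleton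
`Cruxes/ElliottHalberstam/Lines/LiftProof.lean`, planners and refuters can import it).

THE LEVER (all elementary, [folklore]): the relative prime discrepancy is monotone up the divisor lattice of moduli,
`E*(x; q) ≤ (φ(qk)/φ(q)) · E*(x; qk) + ω(k) · log x` for `q, k ≥ 1`, `x ≥ 1` (`primeAPError_le_lift`), from
* the fibre identity `ψ(y; q, a) = Σ_{b mod qk, b ≡ a (q)} ψ(y; qk, b)` (`chebyshevPsiMod_eq_sum_fibre`);
* the exact count of the UNIT fibre, `#{b ∈ (ℤ/qk)ˣ over a} = φ(qk)/φ(q)` (`card_unitFibre_eq`, from the tree's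
  `Literature.AlgebraicGeometry.HodgeTheory.FermatCharacter.totient_mul_card_fiber`), so the main terms match;
* the non-unit part of the fibre carries only prime powers `p^j` with `p ∣ k`: `≤ ω(k) · log x`
  (`sum_nonunitFibre_le`, via `sum_vonMangoldt_filter_dvd_le_log`);
* size facts `card_fibre_le` (`≤ k`), `totient_ratio_le` (`φ(qk)/φ(q) ≤ k`).

Companion files: `…LiftingMultiples` (W-trick normal form), `…LiftingFactorable` (averaged lever and the equivalence
`EH ↔ EHFactorable`). Nothing here asserts the crux; the crux is the Elliott–Halberstam conjecture (open).
-/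

namespace Summit.Parity.GeneralizedHardyLittlewood.Theorems.ElliottHalberstam.Lifting

open scoped BigOperators Classical ArithmeticFunction.vonMangoldt
open Filter Finset Real
open Literature.NumberTheory.Sieve (primeAPError primeAPError_nonneg abs_sub_le_primeAPError)
open Literature.NumberTheory.Sieve.LevelOfDistribution (chebyshevPsiMod)

/-- `ψ(y; q, a)` as a sum of `if`s. -/
theorem chebyshevPsiMod_eq_sum_ite (q : ℕ) (a : ZMod q) (y : ℝ) :
    chebyshevPsiMod q a y = ∑ n ∈ range (⌊y⌋₊ + 1), (if (n : ZMod q) = a then Λ n else 0) := by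
  unfold chebyshevPsiMod
  refine Finset.sum_congr rfl fun n _ => ?_
  simp only [ArithmeticFunction.vonMangoldt.residueClass, Set.indicator_apply, Set.mem_setOf_eq]

/-- FIBRE IDENTITY: `ψ(y; q, a) = Σ_{b mod qk, b ≡ a (q)} ψ(y; qk, b)`. -/
theorem chebyshevPsiMod_eq_sum_fibre (q k : ℕ) [NeZero (q * k)] (a : ZMod q) (y : ℝ) :
    chebyshevPsiMod q a y =
      ∑ b ∈ (univ : Finset (ZMod (q * k))).filter
          (fun b => ZMod.castHom (dvd_mul_right q k) (ZMod q) b = a),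
        chebyshevPsiMod (q * k) b y := by
  simp_rw [chebyshevPsiMod_eq_sum_ite]
  rw [Finset.sum_comm]
  refine Finset.sum_congr rfl fun n _ => ?_
  rw [Finset.sum_ite_eq ((univ : Finset (ZMod (q * k))).filter
      (fun b => ZMod.castHom (dvd_mul_right q k) (ZMod q) b = a)) (n : ZMod (q * k)) (fun _ => (Λ n : ℝ))]
  simp only [Finset.mem_filter, Finset.mem_univ, true_and, map_natCast]

/-- The `Λ`-mass of the multiples of a prime `p` up to `N` is at most `log N`
(all such prime powers divide `p^{⌊log_p N⌋}`, and `Σ_{d ∣ p^K} Λ(d) = log p^K ≤ log N`). -/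
theorem sum_vonMangoldt_filter_dvd_le_log {p : ℕ} (hp : p.Prime) {N : ℕ} (hN : N ≠ 0) :
    ∑ n ∈ (range (N + 1)).filter (p ∣ ·), Λ n ≤ Real.log N := by
  set K : ℕ := Nat.log p N with hK
  have hpK : p ^ K ≤ N := Nat.pow_log_le_self p hN
  have hpK0 : p ^ K ≠ 0 := pow_ne_zero _ hp.ne_zero
  calc ∑ n ∈ (range (N + 1)).filter (p ∣ ·), Λ n
      = ∑ n ∈ ((range (N + 1)).filter (p ∣ ·)).filter (fun n => Λ n ≠ 0), Λ n :=
        (Finset.sum_filter_ne_zero _).symm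
    _ ≤ ∑ d ∈ (p ^ K).divisors, Λ d := by
        refine Finset.sum_le_sum_of_subset_of_nonneg ?_ fun _ _ _ => ArithmeticFunction.vonMangoldt_nonneg
        intro n hn
        simp only [Finset.mem_filter, Finset.mem_range] at hn
        obtain ⟨⟨hnN, hpn⟩, hΛ⟩ := hn
        rw [Nat.mem_divisors]
        refine ⟨?_, hpK0⟩
        obtain ⟨r, e, hr, he, hre⟩ :=
          (isPrimePow_nat_iff _).mp (ArithmeticFunction.vonMangoldt_ne_zero_iff.mp hΛ)
        rw [← hre] at hpn
        have hpr : p = r := (Nat.prime_dvd_prime_iff_eq hp hr).mp (hp.dvd_of_dvd_pow hpn)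
        subst hpr
        rw [← hre]
        refine pow_dvd_pow p (Nat.le_log_of_pow_le hp.one_lt ?_)
        rw [hre]
        omega
    _ = Real.log ((p ^ K : ℕ) : ℝ) := ArithmeticFunction.vonMangoldt_sum
    _ ≤ Real.log (N : ℝ) :=
        Real.log_le_log (by exact_mod_cast Nat.pos_of_ne_zero hpK0) (by exact_mod_cast hpK)

/-- The unit fibre over a unit `a mod q` has exactly `φ(qk)/φ(q)` elements (as a real number);
from the tree's `FermatCharacter.totient_mul_card_fiber`. -/
theorem card_unitFibre_eq {q k : ℕ} [NeZero q] [NeZero (q * k)] (a : (ZMod q)ˣ) :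
    ((#((univ : Finset (ZMod (q * k))).filter
        (fun b => ZMod.castHom (dvd_mul_right q k) (ZMod q) b = a ∧ IsUnit b)) : ℕ) : ℝ)
      = ((q * k).totient : ℝ) / (q.totient : ℝ) := by
  have hq : q ≠ 0 := NeZero.ne q
  have h := Literature.AlgebraicGeometry.HodgeTheory.FermatCharacter.totient_mul_card_fiber
    (m := q * k) (dvd_mul_right q k) (v := (a : ZMod q)) (Units.isUnit a)
  have hφ : (0 : ℝ) < q.totient := by exact_mod_cast Nat.totient_pos.mpr (Nat.pos_of_ne_zero hq)
  rw [eq_div_iff hφ.ne']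
  have hset : ((univ : Finset (ZMod (q * k))).filter
        (fun b => ZMod.castHom (dvd_mul_right q k) (ZMod q) b = a ∧ IsUnit b)) =
      ((univ : Finset (ZMod (q * k))).filter
        (fun u => IsUnit u ∧ ZMod.castHom (dvd_mul_right q k) (ZMod q) u = a)) := by
    ext u
    simp only [mem_filter, mem_univ, true_and]
    exact and_comm
  rw [hset]
  have h' := congrArg (fun n : ℕ => (n : ℝ)) h
  push_cast at h'
  linarith [h']

/-- The non-unit part of the fibre holds only prime powers `p^j` with `p ∣ k`:
`Σ_{b over a, b not a unit} ψ(y; qk, b) ≤ ω(k) · log x` for `1 ≤ y ≤ x`, `a` a unit mod `q`. -/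
theorem sum_nonunitFibre_le {q k : ℕ} [NeZero q] [NeZero (q * k)] (hk : k ≠ 0) (a : (ZMod q)ˣ)
    {x y : ℝ} (hy1 : 1 ≤ y) (hyx : y ≤ x) :
    (∑ b ∈ ((univ : Finset (ZMod (q * k))).filter
          (fun b => ZMod.castHom (dvd_mul_right q k) (ZMod q) b = a)).filter (fun b => ¬ IsUnit b),
        chebyshevPsiMod (q * k) b y)
      ≤ (k.primeFactors.card : ℝ) * Real.log x := by
  set F₂ := ((univ : Finset (ZMod (q * k))).filter
          (fun b => ZMod.castHom (dvd_mul_right q k) (ZMod q) b = a)).filter (fun b => ¬ IsUnit b)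
    with hF₂
  set N : ℕ := ⌊y⌋₊ with hN
  have hN1 : 1 ≤ N := by
    rw [hN]; exact Nat.one_le_floor_iff _ |>.mpr hy1  -- may need adjustment
  have hN0 : N ≠ 0 := by omega
  have hNx : (N : ℝ) ≤ x := (Nat.floor_le (by linarith)).trans hyx
  have hlogN : Real.log N ≤ Real.log x :=
    Real.log_le_log (by exact_mod_cast Nat.pos_of_ne_zero hN0) hNx
  -- expand and swap
  simp_rw [chebyshevPsiMod_eq_sum_ite]
  rw [Finset.sum_comm]
  -- pointwise bound for each n
  have hpt : ∀ n ∈ range (N + 1),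
      (∑ b ∈ F₂, (if (n : ZMod (q * k)) = b then (Λ n : ℝ) else 0)) ≤
        ∑ p ∈ k.primeFactors, (if p ∣ n then (Λ n : ℝ) else 0) := by
    intro n _
    rw [Finset.sum_ite_eq]
    have hnonneg : 0 ≤ ∑ p ∈ k.primeFactors, (if p ∣ n then (Λ n : ℝ) else 0) :=
      Finset.sum_nonneg fun p _ => by
        split_ifs
        · exact ArithmeticFunction.vonMangoldt_nonneg
        · exact le_rfl
    split_ifs with hmem
    · -- n mod qk lies over the unit a but is not a unit: some prime p ∣ k divides n
      rw [hF₂, Finset.mem_filter, Finset.mem_filter] at hmem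
      obtain ⟨⟨-, hπ⟩, hnu⟩ := hmem
      rw [map_natCast] at hπ
      have hcopq : n.Coprime q := by
        have : IsUnit ((n : ℕ) : ZMod q) := by rw [hπ]; exact Units.isUnit a
        exact (ZMod.isUnit_iff_coprime n q).mp this
      have hncop : ¬ n.Coprime k := by
        intro hcopk
        exact hnu ((ZMod.isUnit_iff_coprime n (q * k)).mpr (Nat.Coprime.mul_right hcopq hcopk))
      -- a prime factor of gcd(n,k)
      set g := Nat.gcd n k with hg
      have hg1 : g ≠ 1 := hncop
      set p := g.minFac with hp
      have hpprime : p.Prime := Nat.minFac_prime hg1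
      have hpg : p ∣ g := Nat.minFac_dvd g
      have hpn : p ∣ n := hpg.trans (Nat.gcd_dvd_left n k)
      have hpk : p ∣ k := hpg.trans (Nat.gcd_dvd_right n k)
      have hpmem : p ∈ k.primeFactors := Nat.mem_primeFactors.mpr ⟨hpprime, hpk, hk⟩
      refine le_trans ?_ (Finset.single_le_sum (f := fun p => if p ∣ n then (Λ n : ℝ) else 0)
        (fun p _ => by
          split_ifs
          · exact ArithmeticFunction.vonMangoldt_nonneg
          · exact le_rfl) hpmem)
      simp only [if_pos hpn, le_refl]
    · exact hnonneg
  refine (Finset.sum_le_sum hpt).trans ?_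
  rw [Finset.sum_comm]
  have hinner : ∀ p ∈ k.primeFactors,
      (∑ n ∈ range (N + 1), (if p ∣ n then (Λ n : ℝ) else 0)) ≤ Real.log x := by
    intro p hp
    have hpprime : p.Prime := (Nat.mem_primeFactors.mp hp).1
    rw [← Finset.sum_filter]
    exact (sum_vonMangoldt_filter_dvd_le_log hpprime hN0).trans hlogN
  refine (Finset.sum_le_sum hinner).trans ?_
  rw [Finset.sum_const, nsmul_eq_mul]

/-- Every fibre of `ℤ/qk → ℤ/q` has at most `k` elements (`b ↦ ⌊b/q⌋` is injective on a fibre). -/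
theorem card_fibre_le {q k : ℕ} [NeZero q] [NeZero (q * k)] (a : ZMod q) :
    #((univ : Finset (ZMod (q * k))).filter
        (fun b => ZMod.castHom (dvd_mul_right q k) (ZMod q) b = a)) ≤ k := by
  have hq : 0 < q := Nat.pos_of_ne_zero (NeZero.ne q)
  calc #((univ : Finset (ZMod (q * k))).filter
          (fun b => ZMod.castHom (dvd_mul_right q k) (ZMod q) b = a))
      ≤ #(range k) := by
        refine Finset.card_le_card_of_injOn (fun b => b.val / q) (fun b hb => ?_) ?_
        · rw [Finset.coe_range, Set.mem_Iio, Nat.div_lt_iff_lt_mul hq]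
          exact (ZMod.val_lt b).trans_eq (Nat.mul_comm q k)
        · intro b₁ hb₁ b₂ hb₂ hdiv
          simp only [Finset.coe_filter, Finset.mem_univ, true_and, Set.mem_setOf_eq,
            ZMod.castHom_apply, ZMod.cast_eq_val] at hb₁ hb₂
          have hmod : b₁.val % q = b₂.val % q := by
            rw [← ZMod.natCast_eq_natCast_iff', hb₁, hb₂]
          apply ZMod.val_injective
          rw [← Nat.div_add_mod b₁.val q, ← Nat.div_add_mod b₂.val q, hmod]
          simp only at hdiv
          rw [hdiv]
    _ = k := Finset.card_range k

/-- Hence `φ(qk)/φ(q) ≤ k`. -/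
theorem totient_ratio_le {q k : ℕ} [NeZero q] [NeZero (q * k)] :
    ((q * k).totient : ℝ) / (q.totient : ℝ) ≤ k := by
  obtain ⟨a⟩ : Nonempty (ZMod q)ˣ := ⟨1⟩
  rw [← card_unitFibre_eq (q := q) (k := k) a]
  have h1 : #((univ : Finset (ZMod (q * k))).filter
        (fun b => ZMod.castHom (dvd_mul_right q k) (ZMod q) b = a ∧ IsUnit b)) ≤
      #((univ : Finset (ZMod (q * k))).filter
        (fun b => ZMod.castHom (dvd_mul_right q k) (ZMod q) b = a)) :=
    Finset.card_le_card (Finset.monotone_filter_right _ fun b _ hb => hb.1)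
  exact_mod_cast h1.trans (card_fibre_le (a : ZMod q))

/-- POINTWISE LIFTING (the lever), PROVED: for `q, k ≥ 1` and `x ≥ 1`,
`E*(x; q) ≤ (φ(qk)/φ(q)) · E*(x; qk) + ω(k) · log x`. -/
theorem primeAPError_le_lift {q k : ℕ} (hq : q ≠ 0) (hk : k ≠ 0) {x : ℝ} (hx : 1 ≤ x) :
    primeAPError x q ≤
      ((q * k).totient : ℝ) / (q.totient : ℝ) * primeAPError x (q * k)
        + (k.primeFactors.card : ℝ) * Real.log x := by
  haveI : NeZero q := ⟨hq⟩
  have hm : q * k ≠ 0 := mul_ne_zero hq hk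
  haveI : NeZero (q * k) := ⟨hm⟩
  set R : ℝ := ((q * k).totient : ℝ) / (q.totient : ℝ) with hR
  have hφq : (0 : ℝ) < q.totient := by exact_mod_cast Nat.totient_pos.mpr (Nat.pos_of_ne_zero hq)
  have hφm : (0 : ℝ) < (q * k).totient := by
    exact_mod_cast Nat.totient_pos.mpr (Nat.pos_of_ne_zero hm)
  have hE0 : 0 ≤ primeAPError x (q * k) := primeAPError_nonneg _ _
  haveI : Nonempty (Set.Icc (1 : ℝ) x) := ⟨⟨1, le_rfl, hx⟩⟩
  change (⨆ y : Set.Icc (1 : ℝ) x, ⨆ a : (ZMod q)ˣ,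
      |chebyshevPsiMod q a y - (y : ℝ) / Nat.totient q|) ≤ _
  refine ciSup_le fun y => ciSup_le fun a => ?_
  have hy1 : (1 : ℝ) ≤ y := y.2.1
  have hyx : (y : ℝ) ≤ x := y.2.2
  -- the fibre and its unit / non-unit parts
  set F := (univ : Finset (ZMod (q * k))).filter
      (fun b => ZMod.castHom (dvd_mul_right q k) (ZMod q) b = a) with hF
  set F₁ := F.filter (fun b => IsUnit b) with hF₁
  set F₂ := F.filter (fun b => ¬ IsUnit b) with hF₂
  have hcard : ((#F₁ : ℕ) : ℝ) = R := by
    rw [hF₁, hF, Finset.filter_filter]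
    exact card_unitFibre_eq a
  -- fibre identity and split
  have hsplit : chebyshevPsiMod q a y =
      ∑ b ∈ F₁, chebyshevPsiMod (q * k) b y + ∑ b ∈ F₂, chebyshevPsiMod (q * k) b y := by
    rw [chebyshevPsiMod_eq_sum_fibre q k (a : ZMod q) y, ← hF, hF₁, hF₂,
      Finset.sum_filter_add_sum_filter_not]
  -- the main terms match exactly
  have hmain : (y : ℝ) / Nat.totient q = ∑ b ∈ F₁, (y : ℝ) / Nat.totient (q * k) := by
    rw [Finset.sum_const, nsmul_eq_mul, hcard, hR]
    field_simp
  -- unit part: each term at most E*(x; qk)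
  have hunit : ∀ b ∈ F₁, |chebyshevPsiMod (q * k) b y - (y : ℝ) / Nat.totient (q * k)|
      ≤ primeAPError x (q * k) := by
    intro b hb
    rw [hF₁, Finset.mem_filter] at hb
    obtain ⟨-, hbu⟩ := hb
    have := abs_sub_le_primeAPError (x := x) hm hy1 hyx hbu.unit
    rwa [IsUnit.unit_spec] at this
  -- non-unit part
  have hnon : ∑ b ∈ F₂, chebyshevPsiMod (q * k) b y ≤ (k.primeFactors.card : ℝ) * Real.log x := by
    have := sum_nonunitFibre_le (q := q) hk a hy1 hyx
    rw [← hF, ← hF₂] at this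
    exact this
  have hnon0 : 0 ≤ ∑ b ∈ F₂, chebyshevPsiMod (q * k) b y :=
    Finset.sum_nonneg fun b _ =>
      Finset.sum_nonneg fun n _ => ArithmeticFunction.vonMangoldt.residueClass_nonneg _ n
  -- assemble
  calc |chebyshevPsiMod q a y - (y : ℝ) / Nat.totient q|
      = |∑ b ∈ F₁, (chebyshevPsiMod (q * k) b y - (y : ℝ) / Nat.totient (q * k))
          + ∑ b ∈ F₂, chebyshevPsiMod (q * k) b y| := by
        rw [hsplit, hmain, Finset.sum_sub_distrib]; ring_nf
    _ ≤ |∑ b ∈ F₁, (chebyshevPsiMod (q * k) b y - (y : ℝ) / Nat.totient (q * k))|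
          + |∑ b ∈ F₂, chebyshevPsiMod (q * k) b y| := abs_add_le _ _
    _ ≤ ∑ b ∈ F₁, |chebyshevPsiMod (q * k) b y - (y : ℝ) / Nat.totient (q * k)|
          + ∑ b ∈ F₂, chebyshevPsiMod (q * k) b y := by
        gcongr
        · exact Finset.abs_sum_le_sum_abs _ _
        · rw [abs_of_nonneg hnon0]
    _ ≤ ∑ b ∈ F₁, primeAPError x (q * k) + (k.primeFactors.card : ℝ) * Real.log x := by
        gcongr with b hb
        · exact hunit b hb
    _ = R * primeAPError x (q * k) + (k.primeFactors.card : ℝ) * Real.log x := by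
        rw [Finset.sum_const, nsmul_eq_mul, hcard]

end Summit.Parity.GeneralizedHardyLittlewood.Theorems.ElliottHalberstam.Lifting
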